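/-
Copyright: statement-level skeleton of a published paper (lit-balaban cell, Phase-2 proof seat p25, gen 14). No proof
claims beyond what the kernel checks below.
-/
import Literature.MathematicalPhysics.QuantumFieldTheory.BalabanImbrieJaffe1984to88.BIJ88WickSource305

/-!
# `BalabanImbrieJaffe1984to88.BIJ88WickDerivatives305` — T. Bałaban, J. Imbrie, A. Jaffe, *Effective action and cluster
properties of the abelian Higgs model*, Commun. Math. Phys. **114** (1988) 257–315 [BalabanImbrieJaffe1988], §5.13
p. 305–306 [PDF 49–50] *"We integrate by parts all fields appearing in this formula. Each Φ contracts through a C_s to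
another Φ, to an f(□_i) or to ℱ"* and §5.14 p. 311 [PDF 55] *"We integrate by parts in the Gaussian expectation (5.14.1).
Each F^{m̄}_{k,loc}(X_{σ_i}) is a polynomial in A^{(k)}, φ^{(k)}; those fields can be contracted via covariances
C^{(k)}_{Λ,Γ} or C^{(k)}(u_{k+1}) to other observables, to χ′_{Λ^{(k)}}, or to the interaction"* — **GAUSSIAN INTEGRATION
BY PARTS TO ALL ORDERS WITH A SMOOTH FACTOR**: the complete contraction of a monomial in the fields times a smooth factor
`H` (the `f(□_i)`; the cutoffs `χ′` and the interaction of (5.14.1)), at every degree.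

For `A` positive definite (`C = A⁻¹`), `dμ = e^{−½⟨Φ,AΦ⟩}e^{⟨ℱ,Φ⟩}dΦ`, vectors `v_i` (`i ∈ T`, a finite set of field
labels carrying a linear order), and `H ∈ C^∞` with bounded derivatives of every order:

  `∫ Π_{i∈T} Φ(v_i) · H dμ = Σ_{D ⊆ T} ( Σ_{σ ∈ smallParts (T∖D)} Π_{B∈σ} w_B ) · ∫ (Π_{i∈D} ∂_{C v_i}) H dμ`   (`wick_smooth`)

— `D` = the set of fields contracted INTO THE SMOOTH FACTOR (*"to an f(□_i)"* / *"to χ′ or to the interaction"*: each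
such field becomes a directional derivative `∂_{Cv_i}` of `H`), the remaining fields `T∖D` completely contracted among
themselves and the source: a pair `{i,j}` contributing `w_{{i,j}} = ⟨Cv_i, v_j⟩` (*"through a C_s to another Φ"* /
*"via covariances to other observables"*) and a single field the ℱ-train `w_{{i}} = ⟨Cv_i, ℱ⟩` (*"or to ℱ"*), the sum
running over the set partitions of `T∖D` into blocks of one or two fields (`BIJ88PairingAllOrders5133.smallParts`, the
weights `BIJ88WickSource305.cweight`).  The case `H = 1` is p13's `BIJ88WickSource305.wick_source` (recovered here as
`wick_smooth_const`); the one-field case is p13's replacement rule `BIJ88IntegrationByParts305.ibp_source`.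

statement-level skeleton of published theorems with citation tags; proofs where landed; nothing here is a claim
about the Yang–Mills mass gap

PDF held: `paper:balaban1988-cmp114-bij-abelian-higgs-effective-action` (journal page = PDF page + 256); p. 311 = PDF 55
re-read this session (`lit read … --pages 55-56`, text layer `p0055.txt` L31–36 for the quoted sentence; p. 305–306
quotations as verified by p13 gens 6/12 and r16 on the page images).

CITATION HEADER (lean-in-tree rule).  lit-balaban cell (HOME `run/shared/lean/pub/lit-balaban/`), Phase 2, seat p25
gen 14 (free target, protocol G.5-34(d), TAKING line HOME/STATUS.md 2026-08-22T08:32Z).  Rows of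
`HOME/lit-balaban-r16/ROWS-C2-part2.md` (owner r16, referee ref-5): **C2.Claim@312** (p. 311–312 observable extraction:
this is the integration-by-parts EXPANSION whose term structure p25 gen 13's `BIJ88IbpResult312.ibp_result` /
`BIJ88ObservableExtraction312` took as the displayed datum `hIBP` — here DERIVED for the finite-dimensional Gaussian
measures of the §5.13 model: every term is indexed by which legs are contracted into the smooth weight (`D`) and how the
others pair (`σ`)) and **C2.Eq5.13.3-5.13.4** (flip clause 2, the post-integration-by-parts walk form at every order:
this file is the building block (i) of p13 gen 12's HANDOFF design *"IDEAS LEFT (gen 13) (a)(i) a finite-dim GAUSSIAN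
WICK-WITH-DERIVATIVES theorem … by iterating g6 `ibp_fields`"* — ARCHITECTURE CREDIT: p13 gen 12
(literature-prover-lit-balaban-p13-g12-0); the truncated version, the specialisation to two-leg vertices (chains) and
the plug into `dexp_eq_sum_smallParts` — items (ii)–(iv) of that design — are NOT here and remain p13's lane).
USED BY NAME, nothing restated: p13 g6 `BIJ88IntegrationByParts305.ibp_fields` (one field against a monomial times a
`C¹_b` factor), p13 g12 `BIJ88PairingAllOrders5133.{smallParts, smallParts_empty, mem_smallParts, sum_smallParts_insert}`,
`BIJ88WickSource305.{cweight, cweight_singleton, cweight_pair, inv_dotProduct_comm, wick_source}`, p13 g6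
`BIJ88SDerivative305.integral_weight_mul_source_pos`, `Balaban1983to89.B2Eq228Conditioning.{weight, source}`; Mathlib's
`iteratedFDeriv` calculus (`norm_iteratedFDeriv_fderiv`, `ContinuousLinearMap.iteratedFDeriv_comp_left`,
`Finset.sort_insert`, `Finset.sum_powerset_insert`).  The classical identity is Glimm–Jaffe, *Quantum Physics* §9.1
(9.1.28)/(9.1.32) iterated [GlimmJaffe1987].

## What is proved (0 `sorry`, standard axioms, no new `Prop` facts; two definitions with bodies: `dlist`, `dset`)

* §1 THE CLASS OF SMOOTH FACTORS `H ∈ C^∞`, `sup_Φ ‖D^kH(Φ)‖ < ∞` for every `k` (the `f(□_i)`, smooth cutoffs): it is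
  stable under `H ↦ ∂_uH` (`contDiff_fderiv_apply_const`, `norm_iteratedFDeriv_fderiv_apply_le`
  (`‖D^k(∂_uH)(Φ)‖ ≤ ‖u‖·‖D^{k+1}H(Φ)‖`), `bounds_fderiv_apply_const`) and yields the `C¹_b` data of `ibp_fields`
  (`norm_le_of_iteratedFDeriv_zero`, `norm_fderiv_le_of_iteratedFDeriv_one`); iterated directional derivatives along a
  list `dlist` (head innermost) and along a finite set of field labels `dset A v D H = (Π_{i∈D} ∂_{Cv_i})H` (applied in
  increasing order of the label), `dset_empty`, **`dset_insert`** (a new smallest label is the innermost derivative),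
  `dlist_smooth`/`dset_smooth` (the class is preserved), `dlist_zero`/`dset_const` (derivatives of a constant vanish).
* §2 **`cT_insert`** — adding a field to a complete contraction: `Σ_{σ∈smallParts(R∪{a})} Π w = ⟨Cv_a,ℱ⟩·Σ_{σ∈smallParts R} Π w
  + Σ_{i∈R} ⟨Cv_a,v_i⟩·Σ_{σ∈smallParts(R∖i)} Π w` (p13's `sum_smallParts_insert` with the weights evaluated; the
  combinatorics of `wick_source`); **`rhs_insert`** — the same under the sum over the derivative sets `D ⊆ t` with the
  exchange `Σ_{D⊆t} Σ_{i∈t∖D} = Σ_{i∈t} Σ_{D⊆t∖i}`.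
* §3 **`wick_smooth`** — THE THEOREM (strong induction on `T`, integrating by parts the SMALLEST field `a` against the
  others with `ibp_fields`: the three printed alternatives — another field (induction on `T∖{a,i}`), the smooth factor
  (induction on `T∖a` with `∂_{Cv_a}H`, which is `dset`'s innermost derivative by `dset_insert`), the source ℱ
  (induction on `T∖a`) — recombined by `rhs_insert` and `Finset.sum_powerset_insert`); **`wick_smooth_expect`**
  (normalized by `Z = ∫dμ`: `⟨Π_{i∈T}Φ(v_i)·H⟩ = Σ_D (Σ_σ Π w_B)·⟨(Π_{i∈D}∂_{Cv_i})H⟩`); **`wick_smooth_interacting`** (divided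
  by `∫H dμ` instead: the expectation *in the measure with the factor `H`*, the shape of (5.14.1)'s `⟨·⟩` with
  `H = χ·e^{−V}`: `∫ΠΦ(v_i)H dμ/∫H dμ = Σ_D (Σ_σ Π w_B)·(∫(Π_{i∈D}∂_{Cv_i})H dμ/∫H dμ)`); `wick_smooth_const` (`H` constant:
  only `D = ∅` survives — p13's `wick_source` recovered); `wick_smooth_source_zero` (ℱ = 0: the singleton blocks vanish,
  `cweight_singleton_zero`).
HONEST SCOPE.  (a) Finite-dimensional real Gaussian with linear term, smooth factor with globally bounded derivatives of
all orders (the theorem is applied order by order, so `C^{|T|+1}_b` would suffice; stated for `C^∞` for a clean closure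
property).  (b) This is the EXPANSION MECHANISM of p. 305/p. 311 only: which printed object each contraction produces in
§5.13 (trains `C_s□Δ□C_s…`) or §5.14 (the classification of components into complete/remainder/constant, the random-walk
expansion of the covariance differences, the small factors per contraction and the estimate `|G_k(X)|`) is NOT derived
here — p13's (ii)–(iv) and p25 gen 13's `BIJ88ObservableExtraction312`/`BIJ88IbpResult312` bookkeeping respectively; in
particular print's *"We can arrange the construction so that the {X_c} are determined once the remainder components are
specified"* (a chosen ORDER of integrations by parts, stopping in complete components) is a different, adaptive
expansion: `wick_smooth` integrates by parts EVERY field (no stopping rule), which is the p. 305 procedure verbatim and the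
p. 311 procedure without its stopping rule.  (c) The derivative set `D` is applied in increasing label order
(`dset`); symmetry of mixed derivatives is not used or claimed.  NOT summit progress; NOT continuum; NOT Clay.  Imports
`BIJ88WickSource305` only; modifies nothing.
-/

noncomputable section

namespace Literature.MathematicalPhysics.QuantumFieldTheory.BalabanImbrieJaffe1984to88.BIJ88WickDerivatives305

open MeasureTheory Matrix Finset Function Filter
open scoped BigOperators Topology ContDiff
open Literature.MathematicalPhysics.QuantumFieldTheory.Balaban1983to89
open B2Eq228Conditioning (weight source)
open BIJ88IntegrationByParts305 (ibp_fields isSymm_of_posDef)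
open BIJ88SDerivative305 (integral_weight_mul_source_pos)
open BIJ88PairingAllOrders5133 (smallParts smallParts_empty mem_smallParts sum_smallParts_insert)
open BIJ88WickSource305 (cweight cweight_singleton cweight_pair inv_dotProduct_comm wick_source)

variable {S : Type} [Fintype S]

/-! ## §1  Smooth factors with bounded derivatives of every order; iterated directional derivatives -/

section Smooth

variable {H : (S → ℝ) → ℝ}

/-- `sup|H| ≤ K` from the order-`0` derivative bound (`‖D⁰H(Φ)‖ = ‖H(Φ)‖`): the first `C¹_b` datum of the one-step
rule `ibp_fields`. [folklore] [cite: GlimmJaffe1987, §9.1 (9.1.28)] -/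
theorem norm_le_of_iteratedFDeriv_zero {K : ℝ} (h : ∀ φ : S → ℝ, ‖iteratedFDeriv ℝ 0 H φ‖ ≤ K) (φ : S → ℝ) :
    ‖H φ‖ ≤ K := by
  rw [← norm_iteratedFDeriv_zero (𝕜 := ℝ)]
  exact h φ

/-- `sup‖DH‖ ≤ K` from the order-`1` derivative bound (`‖D⁰(DH)(Φ)‖ = ‖D¹H(Φ)‖`): the second `C¹_b` datum of
`ibp_fields`. [folklore] [cite: GlimmJaffe1987, §9.1 (9.1.28)] -/
theorem norm_fderiv_le_of_iteratedFDeriv_one {K : ℝ} (h : ∀ φ : S → ℝ, ‖iteratedFDeriv ℝ 1 H φ‖ ≤ K) (φ : S → ℝ) :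
    ‖fderiv ℝ H φ‖ ≤ K :=
  calc ‖fderiv ℝ H φ‖ = ‖iteratedFDeriv ℝ 0 (fderiv ℝ H) φ‖ := (norm_iteratedFDeriv_zero (𝕜 := ℝ)).symm
    _ = ‖iteratedFDeriv ℝ (0 + 1) H φ‖ := norm_iteratedFDeriv_fderiv
    _ ≤ K := h φ

/-- The directional derivative `∂_uH : Φ ↦ DH(Φ)u` of a smooth `H` is smooth. [folklore] [cite: GlimmJaffe1987, §9.1 (9.1.28)] -/
theorem contDiff_fderiv_apply_const (hH : ContDiff ℝ ∞ H) (u : S → ℝ) :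
    ContDiff ℝ ∞ fun φ : S → ℝ => fderiv ℝ H φ u :=
  (hH.fderiv_right (m := ∞) (le_of_eq (by simp))).clm_apply contDiff_const

/-- **Bound transfer** `‖D^k(∂_uH)(Φ)‖ ≤ ‖u‖·‖D^{k+1}H(Φ)‖` (`∂_uH = ev_u ∘ DH`, `D^k(ev_u ∘ DH) = ev_u ∘ D^k(DH)` and
`‖D^k(DH)‖ = ‖D^{k+1}H‖`). [folklore] [cite: GlimmJaffe1987, §9.1 (9.1.28)] -/
theorem norm_iteratedFDeriv_fderiv_apply_le (hH : ContDiff ℝ ∞ H) (u : S → ℝ) (k : ℕ) (φ : S → ℝ) :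
    ‖iteratedFDeriv ℝ k (fun ψ : S → ℝ => fderiv ℝ H ψ u) φ‖ ≤ ‖u‖ * ‖iteratedFDeriv ℝ (k + 1) H φ‖ := by
  have hcomp : (fun ψ : S → ℝ => fderiv ℝ H ψ u) = (ContinuousLinearMap.apply ℝ ℝ u) ∘ (fderiv ℝ H) := by
    funext ψ
    simp only [Function.comp_apply, ContinuousLinearMap.apply_apply]
  have hfd : ContDiff ℝ ∞ (fderiv ℝ H) := hH.fderiv_right (m := ∞) (le_of_eq (by simp))
  have hk : (k : WithTop ℕ∞) ≤ ∞ := by exact_mod_cast le_top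
  rw [hcomp, ContinuousLinearMap.iteratedFDeriv_comp_left _ hfd.contDiffAt hk, ← norm_iteratedFDeriv_fderiv]
  refine (ContinuousLinearMap.norm_compContinuousMultilinearMap_le _ _).trans ?_
  have hev : ‖ContinuousLinearMap.apply ℝ ℝ u‖ ≤ ‖u‖ :=
    ContinuousLinearMap.opNorm_le_bound _ (norm_nonneg u) fun L => by
      rw [ContinuousLinearMap.apply_apply, mul_comm]
      exact L.le_opNorm u
  exact mul_le_mul_of_nonneg_right hev (norm_nonneg _)

/-- The class *"smooth with bounded derivatives of every order"* is stable under `H ↦ ∂_uH`.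
[folklore] [cite: GlimmJaffe1987, §9.1 (9.1.28)] -/
theorem bounds_fderiv_apply_const (hH : ContDiff ℝ ∞ H)
    (hb : ∀ k : ℕ, ∃ K : ℝ, ∀ φ : S → ℝ, ‖iteratedFDeriv ℝ k H φ‖ ≤ K) (u : S → ℝ) (k : ℕ) :
    ∃ K : ℝ, ∀ φ : S → ℝ, ‖iteratedFDeriv ℝ k (fun ψ : S → ℝ => fderiv ℝ H ψ u) φ‖ ≤ K := by
  obtain ⟨K, hK⟩ := hb (k + 1)
  exact ⟨‖u‖ * K, fun φ => (norm_iteratedFDeriv_fderiv_apply_le hH u k φ).trans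
    (mul_le_mul_of_nonneg_left (hK φ) (norm_nonneg u))⟩

end Smooth

section DList

/-- **Iterated directional derivative along a list of directions**, head innermost: `dlist [] H = H`,
`dlist (u :: L) H = dlist L (∂_uH)` — the `δ/δΦ`'s of the repeated integrations by parts, in the order they are
performed. [cite: BalabanImbrieJaffe1988, §5.13 p.305–306] [cite: GlimmJaffe1987, §9.1 (9.1.28)] -/
def dlist : List (S → ℝ) → ((S → ℝ) → ℝ) → (S → ℝ) → ℝ
  | [], H => H
  | u :: L, H => dlist L fun φ => fderiv ℝ H φ u

omit [Fintype S] in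
/-- `dlist [] H = H`. [cite: BalabanImbrieJaffe1988, §5.13 p.305–306] -/
@[simp] theorem dlist_nil (H : (S → ℝ) → ℝ) : dlist [] H = H := rfl

omit [Fintype S] in
/-- `dlist (u :: L) H = dlist L (∂_uH)`. [cite: BalabanImbrieJaffe1988, §5.13 p.305–306] -/
@[simp] theorem dlist_cons (u : S → ℝ) (L : List (S → ℝ)) (H : (S → ℝ) → ℝ) :
    dlist (u :: L) H = dlist L (fun φ => fderiv ℝ H φ u) := rfl

/-- Every iterated directional derivative of a smooth factor with bounded derivatives of all orders is again such a
factor. [folklore] [cite: GlimmJaffe1987, §9.1 (9.1.28)] -/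
theorem dlist_smooth : ∀ (L : List (S → ℝ)) {H : (S → ℝ) → ℝ}, ContDiff ℝ ∞ H →
    (∀ k : ℕ, ∃ K : ℝ, ∀ φ : S → ℝ, ‖iteratedFDeriv ℝ k H φ‖ ≤ K) →
    ContDiff ℝ ∞ (dlist L H) ∧ ∀ k : ℕ, ∃ K : ℝ, ∀ φ : S → ℝ, ‖iteratedFDeriv ℝ k (dlist L H) φ‖ ≤ K
  | [], _, hH, hb => ⟨hH, hb⟩
  | u :: L, _, hH, hb => dlist_smooth L (contDiff_fderiv_apply_const hH u) (bounds_fderiv_apply_const hH hb u)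

omit [Fintype S] in
/-- All derivatives of the zero functional vanish. [folklore] [cite: GlimmJaffe1987, §9.1 (9.1.28)] -/
theorem dlist_zero : ∀ L : List (S → ℝ), dlist L (0 : (S → ℝ) → ℝ) = 0
  | [] => rfl
  | u :: L => by
    rw [dlist_cons]
    have : (fun φ : S → ℝ => fderiv ℝ (0 : (S → ℝ) → ℝ) φ u) = 0 := by
      funext φ
      simp
    rw [this]
    exact dlist_zero L

variable [DecidableEq S] {κ : Type} [LinearOrder κ]

/-- **`(Π_{i∈D} ∂_{C v_i}) H`** for a finite set `D` of field labels, `C = A⁻¹`, the derivatives applied in increasing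
order of the label (smallest label innermost). [cite: BalabanImbrieJaffe1988, §5.13 p.305–306] -/
def dset (A : Matrix S S ℝ) (v : κ → S → ℝ) (D : Finset κ) (H : (S → ℝ) → ℝ) : (S → ℝ) → ℝ :=
  dlist ((D.sort (· ≤ ·)).map fun i => A⁻¹ *ᵥ v i) H

/-- No derivative: `dset ∅ H = H`. [cite: BalabanImbrieJaffe1988, §5.13 p.305–306] -/
@[simp] theorem dset_empty (A : Matrix S S ℝ) (v : κ → S → ℝ) (H : (S → ℝ) → ℝ) :
    dset A v (∅ : Finset κ) H = H := by
  simp [dset]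

/-- **A new SMALLEST label is the innermost derivative**: for `a < D`,
`dset (D ∪ {a}) H = dset D (∂_{Cv_a}H)`. [cite: BalabanImbrieJaffe1988, §5.13 p.305–306] -/
theorem dset_insert (A : Matrix S S ℝ) (v : κ → S → ℝ) {a : κ} {D : Finset κ} (ha : ∀ x ∈ D, a < x)
    (H : (S → ℝ) → ℝ) :
    dset A v (insert a D) H = dset A v D (fun φ => fderiv ℝ H φ (A⁻¹ *ᵥ v a)) := by
  have ha' : a ∉ D := fun h => lt_irrefl a (ha a h)
  rw [dset, Finset.sort_insert (s := D) (r := (· ≤ ·)) (fun b hb => (ha b hb).le) ha', List.map_cons, dlist_cons]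
  rfl

/-- `dset D` preserves the class of smooth factors with bounded derivatives of all orders.
[folklore] [cite: GlimmJaffe1987, §9.1 (9.1.28)] -/
theorem dset_smooth (A : Matrix S S ℝ) (v : κ → S → ℝ) (D : Finset κ) {H : (S → ℝ) → ℝ} (hH : ContDiff ℝ ∞ H)
    (hb : ∀ k : ℕ, ∃ K : ℝ, ∀ φ : S → ℝ, ‖iteratedFDeriv ℝ k H φ‖ ≤ K) :
    ContDiff ℝ ∞ (dset A v D H) ∧ ∀ k : ℕ, ∃ K : ℝ, ∀ φ : S → ℝ, ‖iteratedFDeriv ℝ k (dset A v D H) φ‖ ≤ K :=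
  dlist_smooth _ hH hb

/-- Derivatives of a constant factor: `dset D (c) = 0` for `D ≠ ∅` (so that `H = 1` keeps only `D = ∅`).
[folklore] [cite: GlimmJaffe1987, §9.1 (9.1.28)] -/
theorem dset_const (A : Matrix S S ℝ) (v : κ → S → ℝ) {D : Finset κ} (hD : D.Nonempty) (c : ℝ) :
    dset A v D (fun _ => c) = 0 := by
  have ha : D.min' hD ∈ D := min'_mem D hD
  rw [← insert_erase ha, dset_insert A v (fun x hx =>
    lt_of_le_of_ne (min'_le D x (mem_of_mem_erase hx)) (ne_of_mem_erase hx).symm)]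
  have h0 : (fun φ : S → ℝ => fderiv ℝ (fun _ : S → ℝ => c) φ (A⁻¹ *ᵥ v (D.min' hD))) = 0 := by
    funext φ
    simp
  rw [h0, dset]
  exact dlist_zero _

end DList

/-! ## §2  Adding one field to the complete contractions -/

section Combinatorics

variable [DecidableEq S] {κ : Type} [LinearOrder κ]

/-- **Adding a field to a complete contraction** (the combinatorics of p13's `wick_source`, evaluated): for `a ∉ R`,
`Σ_{σ∈smallParts(R∪{a})} Π_{B∈σ} w_B = ⟨Cv_a,ℱ⟩·Σ_{σ∈smallParts R} Π w_B + Σ_{i∈R} ⟨Cv_a,v_i⟩·Σ_{σ∈smallParts(R∖{i})} Π w_B` —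
the new field contracts to ℱ or to one old field `i`. [cite: BalabanImbrieJaffe1988, §5.13 p.305–306] -/
theorem cT_insert {A : Matrix S S ℝ} (hA : A.PosDef) (f : S → ℝ) (v : κ → S → ℝ) {a : κ} {R : Finset κ}
    (haR : a ∉ R) :
    ∑ σ ∈ smallParts (insert a R), ∏ B ∈ σ, cweight A f v B
      = ((A⁻¹ *ᵥ v a) ⬝ᵥ f) * ∑ σ ∈ smallParts R, ∏ B ∈ σ, cweight A f v B
        + ∑ i ∈ R, ((A⁻¹ *ᵥ v a) ⬝ᵥ v i) * ∑ σ ∈ smallParts (R.erase i), ∏ B ∈ σ, cweight A f v B := by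
  rw [sum_smallParts_insert haR]
  congr 1
  · rw [mul_sum]
    refine sum_congr rfl fun σ hσ => ?_
    have hP := (mem_smallParts.1 hσ).1
    have haσ : ({a} : Finset κ) ∉ σ := fun h => haR (hP.subset h (mem_singleton_self a))
    rw [prod_insert haσ, cweight_singleton]
  · refine sum_congr rfl fun i hi => ?_
    rw [mul_sum]
    refine sum_congr rfl fun σ hσ => ?_
    have hP := (mem_smallParts.1 hσ).1
    have hia : i ≠ a := fun e => haR (e ▸ hi)
    have hiaσ : ({i, a} : Finset κ) ∉ σ := fun h =>
      (notMem_erase i R) (hP.subset h (mem_insert_self i {a}))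
    rw [prod_insert hiaσ, cweight_pair hA f v hia, inv_dotProduct_comm hA (v i) (v a)]

/-- **The same under the sum over the derivative sets.**  For `a ∉ t` and any `J`:
`Σ_{D⊆t} (Σ_{σ∈smallParts((t∪{a})∖D)} Π w_B)·J D = ⟨Cv_a,ℱ⟩·Σ_{D⊆t}(Σ_{σ∈smallParts(t∖D)} Π w_B)·J D
 + Σ_{i∈t} ⟨Cv_a,v_i⟩·Σ_{D⊆t∖{i}} (Σ_{σ∈smallParts((t∖{i})∖D)} Π w_B)·J D` (`cT_insert` and the exchange
`Σ_{D⊆t}Σ_{i∈t∖D} = Σ_{i∈t}Σ_{D⊆t∖{i}}`). [cite: BalabanImbrieJaffe1988, §5.13 p.305–306] -/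
theorem rhs_insert {A : Matrix S S ℝ} (hA : A.PosDef) (f : S → ℝ) (v : κ → S → ℝ) {a : κ} {t : Finset κ}
    (hat : a ∉ t) (J : Finset κ → ℝ) :
    ∑ D ∈ t.powerset, (∑ σ ∈ smallParts (insert a t \ D), ∏ B ∈ σ, cweight A f v B) * J D
      = ((A⁻¹ *ᵥ v a) ⬝ᵥ f) * ∑ D ∈ t.powerset, (∑ σ ∈ smallParts (t \ D), ∏ B ∈ σ, cweight A f v B) * J D
        + ∑ i ∈ t, ((A⁻¹ *ᵥ v a) ⬝ᵥ v i) *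
            ∑ D ∈ (t.erase i).powerset, (∑ σ ∈ smallParts (t.erase i \ D), ∏ B ∈ σ, cweight A f v B) * J D := by
  -- `(t ∪ {a}) ∖ D = (t ∖ D) ∪ {a}` for `D ⊆ t`, then `cT_insert`
  have h1 : ∑ D ∈ t.powerset, (∑ σ ∈ smallParts (insert a t \ D), ∏ B ∈ σ, cweight A f v B) * J D
      = ∑ D ∈ t.powerset, ((((A⁻¹ *ᵥ v a) ⬝ᵥ f) * ∑ σ ∈ smallParts (t \ D), ∏ B ∈ σ, cweight A f v B) * J D
          + ∑ i ∈ t \ D, ((A⁻¹ *ᵥ v a) ⬝ᵥ v i) *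
              ((∑ σ ∈ smallParts ((t \ D).erase i), ∏ B ∈ σ, cweight A f v B) * J D)) := by
    refine sum_congr rfl fun D hD => ?_
    have hDt : D ⊆ t := mem_powerset.1 hD
    have haD : a ∉ D := fun h => hat (hDt h)
    have hatD : a ∉ t \ D := fun h => hat (mem_sdiff.1 h).1
    rw [insert_sdiff_of_notMem t haD, cT_insert hA f v hatD, add_mul, sum_mul]
    congr 1
    exact sum_congr rfl fun i _ => by ring
  rw [h1, sum_add_distrib]
  congr 1
  · rw [mul_sum]
    exact sum_congr rfl fun D _ => by ring
  · -- exchange the two sums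
    rw [sum_comm' (t' := t) (s' := fun i => (t.erase i).powerset)
      (fun D i => by
        simp only [Finset.mem_powerset, Finset.mem_sdiff, Finset.subset_erase]
        tauto)]
    refine sum_congr rfl fun i _ => ?_
    rw [mul_sum]
    refine sum_congr rfl fun D _ => ?_
    rw [erase_sdiff_comm]

end Combinatorics

/-! ## §3  Gaussian integration by parts to all orders with a smooth factor -/

section Main

variable [DecidableEq S] {κ : Type} [LinearOrder κ]

/-- **GAUSSIAN INTEGRATION BY PARTS TO ALL ORDERS WITH A SMOOTH FACTOR** (*"Each Φ contracts through a C_s to another Φ,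
to an f(□_i) or to ℱ"*, p. 305–306; *"those fields can be contracted via covariances … to other observables, to χ′, or
to the interaction"*, p. 311): for `A` positive definite (`C = A⁻¹`), a monomial `Π_{i∈T}Φ(v_i)` and `H ∈ C^∞` with
bounded derivatives of every order,
`∫ Π_{i∈T}Φ(v_i)·H e^{−½⟨Φ,AΦ⟩}e^{⟨ℱ,Φ⟩}dΦ = Σ_{D⊆T} (Σ_{σ∈smallParts(T∖D)} Π_{B∈σ} w_B) · ∫ (Π_{i∈D}∂_{Cv_i})H e^{−½⟨Φ,AΦ⟩}e^{⟨ℱ,Φ⟩}dΦ`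
— `D` the fields contracted into `H`, pairs `w_{{i,j}} = ⟨Cv_i,v_j⟩`, singletons `w_{{i}} = ⟨Cv_i,ℱ⟩`.
[cite: BalabanImbrieJaffe1988, §5.13 p.305–306] [cite: BalabanImbrieJaffe1988, §5.14 p.311] [cite: GlimmJaffe1987, §9.1 (9.1.28), (9.1.32)] -/
theorem wick_smooth (A : Matrix S S ℝ) (hA : A.PosDef) (f : S → ℝ) (v : κ → S → ℝ) (T : Finset κ)
    {H : (S → ℝ) → ℝ} (hH : ContDiff ℝ ∞ H) (hb : ∀ k : ℕ, ∃ K : ℝ, ∀ φ : S → ℝ, ‖iteratedFDeriv ℝ k H φ‖ ≤ K) :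
    ∫ φ : S → ℝ, (∏ i ∈ T, φ ⬝ᵥ v i) * H φ * (weight A φ * source f φ)
      = ∑ D ∈ T.powerset, (∑ σ ∈ smallParts (T \ D), ∏ B ∈ σ, cweight A f v B) *
          ∫ φ : S → ℝ, dset A v D H φ * (weight A φ * source f φ) := by
  induction T using Finset.strongInduction generalizing H with
  | H T ih =>
    rcases T.eq_empty_or_nonempty with hT | hne
    · subst hT
      simp [smallParts_empty]
    · -- peel the smallest field label `a`
      have ha : T.min' hne ∈ T := min'_mem T hne
      set a := T.min' hne with ha_def
      set t := T.erase a with ht_def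
      have hat : a ∉ t := notMem_erase a T
      have hTt : insert a t = T := insert_erase ha
      have hlt : ∀ x ∈ t, a < x := fun x hx =>
        lt_of_le_of_ne (ha_def ▸ min'_le T x (mem_of_mem_erase hx)) (ne_of_mem_erase hx).symm
      have htT : t ⊂ T := erase_ssubset ha
      -- the `C¹_b` data of `H`, and the derivative factor `∂_{Cv_a}H` in the class
      obtain ⟨K₀, hK₀⟩ := hb 0
      obtain ⟨K₁, hK₁⟩ := hb 1
      have h0 : ∀ φ : S → ℝ, ‖H φ‖ ≤ K₀ := norm_le_of_iteratedFDeriv_zero hK₀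
      have h1 : ∀ φ : S → ℝ, ‖fderiv ℝ H φ‖ ≤ K₁ := norm_fderiv_le_of_iteratedFDeriv_one hK₁
      have hH1 : ContDiff ℝ 1 H := hH.of_le (by exact_mod_cast le_top)
      have hHa := contDiff_fderiv_apply_const hH (A⁻¹ *ᵥ v a)
      have hba := bounds_fderiv_apply_const hH hb (A⁻¹ *ᵥ v a)
      -- one integration by parts of the field `a`
      have e : ∫ φ : S → ℝ, (∏ i ∈ T, φ ⬝ᵥ v i) * H φ * (weight A φ * source f φ)
          = ∫ φ : S → ℝ, (φ ⬝ᵥ v a) * ((∏ i ∈ t, φ ⬝ᵥ v i) * H φ) * (weight A φ * source f φ) := by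
        congr 1
        funext φ
        rw [← Finset.mul_prod_erase T (fun i => φ ⬝ᵥ v i) ha]
        ring
      rw [e, ibp_fields A hA f t v hH1 h0 h1 (v a)]
      -- the three alternatives, each by the induction hypothesis
      have hder : ∫ φ : S → ℝ, (∏ i ∈ t, φ ⬝ᵥ v i) * fderiv ℝ H φ (A⁻¹ *ᵥ v a) * (weight A φ * source f φ)
          = ∑ D ∈ t.powerset, (∑ σ ∈ smallParts (t \ D), ∏ B ∈ σ, cweight A f v B) *
              ∫ φ : S → ℝ, dset A v D (fun ψ => fderiv ℝ H ψ (A⁻¹ *ᵥ v a)) φ * (weight A φ * source f φ) :=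
        ih t htT hHa hba
      rw [hder, ih t htT hH hb,
        sum_congr rfl fun i hi => by rw [ih (t.erase i) ((erase_ssubset hi).trans htT) hH hb]]
      -- the right-hand side for `T = t ∪ {a}`: derivative sets with / without `a`
      rw [← hTt, Finset.sum_powerset_insert hat, rhs_insert hA f v hat]
      have h2 : ∑ D ∈ t.powerset, (∑ σ ∈ smallParts (insert a t \ insert a D), ∏ B ∈ σ, cweight A f v B) *
            ∫ φ : S → ℝ, dset A v (insert a D) H φ * (weight A φ * source f φ)
          = ∑ D ∈ t.powerset, (∑ σ ∈ smallParts (t \ D), ∏ B ∈ σ, cweight A f v B) *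
            ∫ φ : S → ℝ, dset A v D (fun ψ => fderiv ℝ H ψ (A⁻¹ *ᵥ v a)) φ * (weight A φ * source f φ) := by
        refine sum_congr rfl fun D hD => ?_
        have hDt : D ⊆ t := mem_powerset.1 hD
        rw [insert_sdiff_insert, sdiff_insert_of_notMem hat, dset_insert A v (fun x hx => hlt x (hDt hx))]
      rw [h2]
      ring

/-- **Normalized form**: with `Z = ∫ e^{−½⟨Φ,AΦ⟩}e^{⟨ℱ,Φ⟩}dΦ` and `⟨G⟩ := Z⁻¹∫ G dμ`,
`⟨Π_{i∈T}Φ(v_i)·H⟩ = Σ_{D⊆T} (Σ_{σ∈smallParts(T∖D)} Π w_B) · ⟨(Π_{i∈D}∂_{Cv_i})H⟩`.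
[cite: BalabanImbrieJaffe1988, §5.13 p.305–306] [cite: BalabanImbrieJaffe1988, §5.14 p.311] -/
theorem wick_smooth_expect (A : Matrix S S ℝ) (hA : A.PosDef) (f : S → ℝ) (v : κ → S → ℝ) (T : Finset κ)
    {H : (S → ℝ) → ℝ} (hH : ContDiff ℝ ∞ H) (hb : ∀ k : ℕ, ∃ K : ℝ, ∀ φ : S → ℝ, ‖iteratedFDeriv ℝ k H φ‖ ≤ K) :
    (∫ φ : S → ℝ, (∏ i ∈ T, φ ⬝ᵥ v i) * H φ * (weight A φ * source f φ)) / (∫ φ : S → ℝ, weight A φ * source f φ)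
      = ∑ D ∈ T.powerset, (∑ σ ∈ smallParts (T \ D), ∏ B ∈ σ, cweight A f v B) *
          ((∫ φ : S → ℝ, dset A v D H φ * (weight A φ * source f φ)) / ∫ φ : S → ℝ, weight A φ * source f φ) := by
  rw [wick_smooth A hA f v T hH hb, sum_div]
  exact sum_congr rfl fun D _ => by rw [mul_div_assoc]

/-- **The expectation in the measure carrying the factor `H`** (the shape of (5.14.1)'s `⟨·⟩` with `H = χ·e^{−V}`,
normalized by `∫H dμ` — the fields contracted into `H` are the contractions *"to χ′ or to the interaction"*):
`∫Π_{i∈T}Φ(v_i)H dμ / ∫H dμ = Σ_{D⊆T} (Σ_{σ∈smallParts(T∖D)} Π w_B)·(∫(Π_{i∈D}∂_{Cv_i})H dμ / ∫H dμ)`.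
[cite: BalabanImbrieJaffe1988, §5.14 p.311] [cite: BalabanImbrieJaffe1988, (5.14.1) p.308] -/
theorem wick_smooth_interacting (A : Matrix S S ℝ) (hA : A.PosDef) (f : S → ℝ) (v : κ → S → ℝ) (T : Finset κ)
    {H : (S → ℝ) → ℝ} (hH : ContDiff ℝ ∞ H) (hb : ∀ k : ℕ, ∃ K : ℝ, ∀ φ : S → ℝ, ‖iteratedFDeriv ℝ k H φ‖ ≤ K) :
    (∫ φ : S → ℝ, (∏ i ∈ T, φ ⬝ᵥ v i) * H φ * (weight A φ * source f φ))
        / (∫ φ : S → ℝ, H φ * (weight A φ * source f φ))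
      = ∑ D ∈ T.powerset, (∑ σ ∈ smallParts (T \ D), ∏ B ∈ σ, cweight A f v B) *
          ((∫ φ : S → ℝ, dset A v D H φ * (weight A φ * source f φ))
            / ∫ φ : S → ℝ, H φ * (weight A φ * source f φ)) := by
  rw [wick_smooth A hA f v T hH hb, sum_div]
  exact sum_congr rfl fun D _ => by rw [mul_div_assoc]

/-- **Constant factor: p13's `wick_source` recovered** — for `H = c` only `D = ∅` survives (`dset_const`), and
`∫Π_{i∈T}Φ(v_i)·c dμ = (Σ_{σ∈smallParts T} Π w_B)·∫ c dμ`. [cite: BalabanImbrieJaffe1988, §5.13 p.305–306] -/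
theorem wick_smooth_const (A : Matrix S S ℝ) (hA : A.PosDef) (f : S → ℝ) (v : κ → S → ℝ) (T : Finset κ) (c : ℝ) :
    ∫ φ : S → ℝ, (∏ i ∈ T, φ ⬝ᵥ v i) * c * (weight A φ * source f φ)
      = (∑ σ ∈ smallParts T, ∏ B ∈ σ, cweight A f v B) * ∫ φ : S → ℝ, c * (weight A φ * source f φ) := by
  have hH : ContDiff ℝ ∞ (fun _ : S → ℝ => c) := contDiff_const
  have hb : ∀ k : ℕ, ∃ K : ℝ, ∀ φ : S → ℝ, ‖iteratedFDeriv ℝ k (fun _ : S → ℝ => c) φ‖ ≤ K := fun k => by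
    refine ⟨‖c‖, fun φ => ?_⟩
    rcases Nat.eq_zero_or_pos k with hk | hk
    · subst hk
      rw [norm_iteratedFDeriv_zero]
    · rw [iteratedFDeriv_const_of_ne (𝕜 := ℝ) (Nat.pos_iff_ne_zero.1 hk) c]
      simp
  have h := wick_smooth A hA f v T hH hb
  rw [← sum_erase_add _ _ (empty_mem_powerset T)] at h
  rw [h, sum_eq_zero fun D hD => ?_, zero_add, sdiff_empty, dset_empty]
  have hDne : D.Nonempty := nonempty_iff_ne_empty.2 (ne_of_mem_erase hD)
  rw [dset_const A v hDne c]
  simp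

/-- Without source the ℱ-trains vanish: `w_{{i}} = ⟨Cv_i, 0⟩ = 0`. [cite: BalabanImbrieJaffe1988, §5.13 p.305–306] -/
theorem cweight_singleton_zero (A : Matrix S S ℝ) (v : κ → S → ℝ) (i : κ) : cweight A (0 : S → ℝ) v {i} = 0 := by
  rw [cweight_singleton, dotProduct_zero]

/-- **Centred case** (`ℱ = 0`, the measure `dμ_{C}` of (5.14.1) without linear term): a small partition with a
singleton block contributes nothing, so only the fields contracted into `H` and the PAIRINGS of the others remain:
`∫Π_{i∈T}Φ(v_i)·H dμ_C = Σ_{D⊆T} (Σ_{σ∈smallParts(T∖D), all blocks pairs} Π_{B∈σ}⟨Cv,v⟩)·∫(Π_{i∈D}∂_{Cv_i})H dμ_C`.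
[cite: BalabanImbrieJaffe1988, §5.14 p.311] [cite: GlimmJaffe1987, §9.1 (9.1.28)] -/
theorem wick_smooth_source_zero (A : Matrix S S ℝ) (hA : A.PosDef) (v : κ → S → ℝ) (T : Finset κ)
    {H : (S → ℝ) → ℝ} (hH : ContDiff ℝ ∞ H) (hb : ∀ k : ℕ, ∃ K : ℝ, ∀ φ : S → ℝ, ‖iteratedFDeriv ℝ k H φ‖ ≤ K) :
    ∫ φ : S → ℝ, (∏ i ∈ T, φ ⬝ᵥ v i) * H φ * (weight A φ * source 0 φ)
      = ∑ D ∈ T.powerset,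
          (∑ σ ∈ (smallParts (T \ D)).filter (fun σ => ∀ B ∈ σ, B.card = 2), ∏ B ∈ σ, cweight A 0 v B) *
          ∫ φ : S → ℝ, dset A v D H φ * (weight A φ * source 0 φ) := by
  rw [wick_smooth A hA 0 v T hH hb]
  refine sum_congr rfl fun D _ => ?_
  congr 1
  rw [sum_filter]
  refine sum_congr rfl fun σ hσ => ?_
  split_ifs with h
  · rfl
  · -- a block of one field: its weight is `⟨Cv_i, 0⟩ = 0`
    obtain ⟨hP, hsm⟩ := mem_smallParts.1 hσ
    simp only [not_forall, exists_prop] at h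
    obtain ⟨B, hB, hB2⟩ := h
    have hBne : B.Nonempty := hP.nonempty_of_mem hB
    have hB1 : B.card = 1 := by
      have := hsm B hB
      have := hBne.card_pos
      omega
    obtain ⟨i, rfl⟩ := card_eq_one.1 hB1
    exact prod_eq_zero hB (cweight_singleton_zero A v i)

end Main

end Literature.MathematicalPhysics.QuantumFieldTheory.BalabanImbrieJaffe1984to88.BIJ88WickDerivatives305
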